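import Summits.AtomisticToContinuum.Crystallization.Theorems.ChartedPlanarOrderTubeChannelsB
import Summits.AtomisticToContinuum.Crystallization.Theorems.ChartedPlanarOrderTubeLipschitz

-- PART C of lens-3 g24 `ChartedPlanarOrderTubeChannels.lean` v3 (sha256 3e7f449b59e1cdbe…; this part = its lines 496–760): §8 leaf structure of
-- CHꜰ (splice), §9 W′ level `TubeChannelsW'`, §10 W′ leaves, §11 record corollaries + cones.  Imports PART B and (w) `…TubeLipschitz`.

/-!
# 7c′ᶜ ⟸ CHANNEL DOMINANCE — a typed split beneath the convexity half of slot 7c′, with the seam PROVED (decomp-a2c lens-3 g24, task (x))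

Slot 7c′ of lens-4's UniformCut cone is, after (t) `…TubeConvexSplit`, (u) `…StraddleLipschitz`, (v) `…PairModulus` and (w) `…TubeLipschitz`,
its CONVEXITY HALF 7c′ᶜ `TubeConvexityW' (17/16) (1/40)` alone: the global ℓ²-monotonicity (`IsTubeConvex a b w ρ λ`, `λ > 0`) of the gap-stress
map `h ↦ (gapStress a b m h)_m` on the `ρ`-tube round the increment profile of every admissible zero-gap-stress stacked configuration.

## The split (why CHANNELS and not norms)

Pair the gap-stress difference with `d = h − h'` and rearrange by layer pairs `(k, l)`:
`Σ_m ⟪ΔgapStress_m, d_m⟫ = Σ_{k<l} ⟪ΔF_{kl}, D_{kl}⟫`, `D_{kl} = Σ_{k<i≤l} d_i` (`sum_inner_partial_eq`, `sum_filter_eq_Df`).  ADJACENT pairs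
(`l = k + 1`, `D = d_l`) carry the stiffness; FAR pairs (span `s = l − k ≥ 2`) may soften, and `‖D_{kl}‖² ≤ s Σ_window ‖d_i‖²` costs a factor `s`
per pair and `s` pairs per site, i.e. `s²` per span.  The ISOTROPIC version of this bookkeeping needs `λ₁ > Σ_{s≥2} s² τ_s` with ONE adjacent modulus
`λ₁` against the far pair moduli `τ_s` — that is exactly the scalar own-gap dominance RETIRED by critic R1 / census TAG 161 (numerically thin at
`ρ = 1/40`, false at `ρ ≥ 1/50`): the adjacent secant form is stiff in the NORMAL channel (`k_nn ≈ 20`) and soft in the TANGENTIAL one, while the far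
softening is almost entirely NORMAL.  Census TAG 161b (i) read BLOCKWISE passes with lateral margin `1.66–2.31` at `ρ = 0.04`.  Hence the split is by
CHANNELS with respect to a unit normal `ν` (`tng ν x = x − ⟪ν, x⟫ ν`, `⟪ν, x⟫`), in DIAGONAL form — tangential/normal cross blocks are absorbed
by the certifier with weighted AM–GM (`cross_absorb`: `2 c x y ≤ p x² + q y²` for `c² ≤ p q`), the weight at his choice, per pair type and span:

* ★ CHᴬ `IsAdjacentChannelMono a b w ρ ν λ_T λ_N` — on every tube window the adjacent-layer force map has secant form `≥ λ_T ‖d_T‖² + λ_N d_N²`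
  [CERT: ONE explicit planar lattice sum on ONE ball of radius `ρ`];
* ★ CHꜰ `IsFarChannelModulus a b w ρ ν μ_T μ_N` — for spans `s ≥ 2` the pair force map has secant form `≥ −(μ_T(s) ‖D_T‖² + μ_N(s) D_N²)`
  [CERT for small `s` · ANALYTIC tail, one derivative up from (v)'s `O(s⁻⁶)` Lipschitz span moduli];
* the DOMINANCE is required IN EACH CHANNEL SEPARATELY: `λ + Σ_{s≥2} s² μ_T(s) ≤ λ_T` and `λ + Σ_{s≥2} s² μ_N(s) ≤ λ_N` (`TubeChannelData a b w ρ`;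
  the span-square budgets are uniform bounds `B_T`, `B_N` on the partial sums — no tsum bookkeeping for the consumer).

## Proved here (sorry-free; standard axioms)

* ★★ `isTubeConvex_of_channels` — THE SEAM: straddle summability on the tube + CHᴬ + CHꜰ + channelwise dominance ⇒ `IsTubeConvex a b w ρ λ`
  (finite Fubini over boxes of layer pairs, Jensen on the windows, the window count `sum_window_weight_le`
  (`≤ s` windows of span `s` per site, uniformly in the box), and the limit `R → ∞` through `HasSum` of the straddle families);
  `tubeConvexityData_of_channels` (data level);
* ★ the LEAF STRUCTURE of CHꜰ (§8): `isFarChannelModulus_of_isPairModulus` (Cauchy–Schwarz: a Lipschitz span modulus is an isotropic far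
  channel modulus — adequate for the TAIL of spans only), `IsFarChannelModulusBelow … s₀` (the finitely many spans `< s₀`, CERT),
  `isFarChannelModulus_splice`, `splice_budget`, `tubeChannelData_of_certs` (CHᴬ + finitely many far certificates + one Lipschitz tail with an
  explicit budget + arithmetic ⇒ channel dominance data);
* ★ W′ level: `TubeChannelsW' Λ ρ` / `TubeChannelsW Λ ρ` (binder lists of `TubeConvexW'` / `TubeConvexW` verbatim) and
  `tubeConvexityW'_of_pairModulus_channels : PairModulusW' Λ ρ → TubeChannelsW' Λ ρ → TubeConvexityW' Λ ρ` (tube summability from the pair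
  moduli via (u)'s `summable_famOf_tube`);
* ★ W′-level LEAVES with explicit constant slots (§10): `AdjacentChannelW' Λ ρ λ_T λ_N`, `FarChannelBelowW' Λ ρ μ_T μ_N s₀`,
  `PairModulusTailW' Λ ρ s₀ B₂` (channels w.r.t. any unit normal `ν ⊥ a, b`; `exists_unit_normal` from `cleanStackedIndependentW`) and the glue
  `tubeChannelsW'_of_leaves : … → TubeChannelsW' Λ ρ`; `tubeConvexW'_record_of_leaves` (§11);
* ★★ unconditional in the range of (v)/(w) (`Λ ≤ 17/16`, `ρ < 19/50`): `tubeConvexityW'_of_channels`, `tubeConvexW'_of_channels`,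
  `tubeConvexW'_record_of_channels : TubeChannelsW' (17/16) (1/40) → TubeConvexW' (17/16) (1/40)`, the F2 feeder `tubeUniquenessW_of_channels`,
  the PS column `profileSlavingLJW_of_channels`, and lens-4's RDEF cone with slot 7 = CH: `rdef_of_grossU_shape_gluing_pinning_channels`
  (+ `_record` at `(2, 17/16; 1/40, 3/16)`).

So: SLOT 7c′ ⟸ 7c′ᶜ ⟸ CH `TubeChannelsW' (17/16) (1/40)` ⟸ LEAVES `AdjacentChannelW'` ∧ `FarChannelBelowW' … s₀` ∧ `PairModulusTailW' … s₀ B₂`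
∧ arithmetic, whose content is two families of EXPLICIT-FUNCTION-ON-A-BALL certificates (one adjacent, finitely many far) plus an analytic tail — the block-Toeplitz symbol certificate asked of lens-3 g25 (critic row 472) in secant (derivative-free) form.

Conventions: `E3 = EuclideanSpace ℝ (Fin 3)` (`…ChunkFloor.E3`); `tube`, `incr`, `gapStress`, `offsetOf`, `layerForce`, `Straddle` from
`…ProfileSlavingLJ`; `famOf` from `…TubeMonotoneSplit`.  No instances, no notation, no new axioms.
-/

noncomputable section

namespace Summit.AtomisticToContinuum.Crystallization.Theorems.ChartedPlanarOrderTubeChannels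

open Finset Metric Filter Topology
open scoped RealInnerProductSpace
open Summit.AtomisticToContinuum.Crystallization.Theorems.ChartedPlanarOrderChunkFloor (E3)
open Summit.AtomisticToContinuum.Crystallization.Theorems.ChartedPlanarOrderProfileSlavingLJ (Straddle IsStacked gapStress incr tube
  offsetOf layerForce)
open Summit.AtomisticToContinuum.Crystallization.Theorems.ChartedPlanarOrderTubeMonotoneSplit (IsPairModulus famOf gapStress_eq_tsum
  offsetOf_pred)
open Summit.AtomisticToContinuum.Crystallization.Theorems.ChartedPlanarOrderTubeConvex (IsTubeConvex)
open Summit.AtomisticToContinuum.Crystallization.Theorems.ChartedPlanarOrderTubeConvexSplit (TubeConvexityData)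

/-! ## §8 The leaf structure of CHꜰ: finitely many certified spans, spliced with a Lipschitz span modulus for the tail -/

section Splice

variable {a b : E3} {w : ℤ → E3} {ρ : ℝ} {ν : E3}

/-- Cauchy–Schwarz: a Lipschitz span modulus `τ` ((u)/(v)'s `IsPairModulus`) is an ISOTROPIC far channel modulus in both channels
(adequate only for the TAIL of spans, where `τ` is tiny; for small spans the tangential modulus must come from a channel-resolved certificate). -/
theorem isFarChannelModulus_of_isPairModulus {τ : ℕ → ℝ} (hν : ‖ν‖ = 1) (hP : IsPairModulus a b w ρ τ) :
    IsFarChannelModulus a b w ρ ν τ τ := by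
  intro k l hkl h h' hh hh'
  have h1 := hP k l (by omega) h h' hh hh'
  set X := layerForce a b (-offsetOf h k l) - layerForce a b (-offsetOf h' k l)
  set D := offsetOf h k l - offsetOf h' k l
  rw [← mul_add, ← norm_sq_channels hν D, sq, ← mul_assoc]
  have h2 : |⟪X, D⟫| ≤ ‖X‖ * ‖D‖ := abs_real_inner_le_norm X D
  have h3 : ‖X‖ * ‖D‖ ≤ τ (l - k).toNat * ‖D‖ * ‖D‖ := mul_le_mul_of_nonneg_right h1 (norm_nonneg D)
  rw [abs_le] at h2
  linarith [h2.1]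

/-- ★ piece CHꜰ below `s₀` · `IsFarChannelModulusBelow a b w ρ ν μ_T μ_N s₀` — the far channel moduli for the finitely many spans `2 ≤ s < s₀`
only. [CERT · finitely many explicit lattice sums along span-`s` tube windows] -/
def IsFarChannelModulusBelow (a b : E3) (w : ℤ → E3) (ρ : ℝ) (ν : E3) (μT μN : ℕ → ℝ) (s₀ : ℕ) : Prop :=
  ∀ k l : ℤ, k + 2 ≤ l → (l - k).toNat < s₀ → ∀ h h' : ℤ → E3, (∀ i, h i ∈ tube w ρ i) → (∀ i, h' i ∈ tube w ρ i) →
    -(μT (l - k).toNat * ‖tng ν (offsetOf h k l - offsetOf h' k l)‖ ^ 2 + μN (l - k).toNat * ⟪ν, offsetOf h k l - offsetOf h' k l⟫ ^ 2) ≤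
      ⟪layerForce a b (-offsetOf h k l) - layerForce a b (-offsetOf h' k l), offsetOf h k l - offsetOf h' k l⟫

/-- The full far-channel modulus implies the truncated one. [folklore] -/
theorem isFarChannelModulusBelow_of_isFarChannelModulus {μT μN : ℕ → ℝ} (hF : IsFarChannelModulus a b w ρ ν μT μN) (s₀ : ℕ) :
    IsFarChannelModulusBelow a b w ρ ν μT μN s₀ :=
  fun k l hkl _ h h' hh hh' => hF k l hkl h h' hh hh'

/-- ★ SPLICE: certified channel moduli for the spans `< s₀` and a Lipschitz span modulus `τ` for the tail give CHꜰ with the spliced moduli. -/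
theorem isFarChannelModulus_splice {μT μN τ : ℕ → ℝ} {s₀ : ℕ} (hν : ‖ν‖ = 1) (hB : IsFarChannelModulusBelow a b w ρ ν μT μN s₀)
    (hP : IsPairModulus a b w ρ τ) :
    IsFarChannelModulus a b w ρ ν (fun s => if s < s₀ then μT s else τ s) (fun s => if s < s₀ then μN s else τ s) := by
  intro k l hkl h h' hh hh'
  by_cases hs : (l - k).toNat < s₀
  · simp only [if_pos hs]
    exact hB k l hkl hs h h' hh hh'
  · simp only [if_neg hs]
    exact isFarChannelModulus_of_isPairModulus hν hP k l hkl h h' hh hh'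

/-- the span-square budget of spliced moduli: the finite certified part plus a uniform tail budget of `τ` from `s₀` on. -/
theorem splice_budget {μ τ : ℕ → ℝ} {s₀ : ℕ} {B₁ B₂ : ℝ} (hμ : ∀ s, 0 ≤ μ s) (hτ : ∀ s, 0 ≤ τ s)
    (h₁ : ∑ s ∈ Finset.Ico 2 s₀, ((s : ℕ) : ℝ) ^ 2 * μ s ≤ B₁) (h₂ : ∀ N : ℕ, ∑ s ∈ Finset.Ico s₀ N, ((s : ℕ) : ℝ) ^ 2 * τ s ≤ B₂) (N : ℕ) :
    ∑ s ∈ Finset.Ico 2 N, ((s : ℕ) : ℝ) ^ 2 * (if s < s₀ then μ s else τ s) ≤ B₁ + B₂ := by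
  rw [← Finset.sum_filter_add_sum_filter_not (Finset.Ico 2 N) (fun s => s < s₀)]
  have e1 : ∑ s ∈ (Finset.Ico 2 N).filter (fun s => s < s₀), ((s : ℕ) : ℝ) ^ 2 * (if s < s₀ then μ s else τ s) =
      ∑ s ∈ (Finset.Ico 2 N).filter (fun s => s < s₀), ((s : ℕ) : ℝ) ^ 2 * μ s :=
    Finset.sum_congr rfl fun s hs => by rw [if_pos (Finset.mem_filter.mp hs).2]
  have e2 : ∑ s ∈ (Finset.Ico 2 N).filter (fun s => ¬ s < s₀), ((s : ℕ) : ℝ) ^ 2 * (if s < s₀ then μ s else τ s) =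
      ∑ s ∈ (Finset.Ico 2 N).filter (fun s => ¬ s < s₀), ((s : ℕ) : ℝ) ^ 2 * τ s :=
    Finset.sum_congr rfl fun s hs => by rw [if_neg (Finset.mem_filter.mp hs).2]
  rw [e1, e2]
  have i1 : ∑ s ∈ (Finset.Ico 2 N).filter (fun s => s < s₀), ((s : ℕ) : ℝ) ^ 2 * μ s ≤ ∑ s ∈ Finset.Ico 2 s₀, ((s : ℕ) : ℝ) ^ 2 * μ s :=
    Finset.sum_le_sum_of_subset_of_nonneg
      (fun s hs => by simp only [Finset.mem_filter, Finset.mem_Ico] at hs ⊢; omega) (fun s _ _ => mul_nonneg (by positivity) (hμ s))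
  have i2 : ∑ s ∈ (Finset.Ico 2 N).filter (fun s => ¬ s < s₀), ((s : ℕ) : ℝ) ^ 2 * τ s ≤ ∑ s ∈ Finset.Ico s₀ N, ((s : ℕ) : ℝ) ^ 2 * τ s :=
    Finset.sum_le_sum_of_subset_of_nonneg
      (fun s hs => by simp only [Finset.mem_filter, Finset.mem_Ico] at hs ⊢; omega) (fun s _ _ => mul_nonneg (by positivity) (hτ s))
  linarith [h₂ N]

/-- ★★ **the leaf structure of CH**: ONE adjacent channel certificate CHᴬ, FINITELY MANY far channel certificates (spans `< s₀`), ONE Lipschitz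
span modulus `τ` with an explicit uniform tail budget `Σ_{s₀ ≤ s < N} s² τ_s ≤ B₂` (analytic; (v) gives `τ_s = K s⁻⁶` explicitly), and the
channelwise dominance arithmetic — together they are channel dominance data. -/
theorem tubeChannelData_of_certs {lT lN lam B₁T B₁N B₂ : ℝ} {μT μN τ : ℕ → ℝ} {s₀ : ℕ} (hν : ‖ν‖ = 1)
    (hA : IsAdjacentChannelMono a b w ρ ν lT lN) (hB : IsFarChannelModulusBelow a b w ρ ν μT μN s₀) (hP : IsPairModulus a b w ρ τ)
    (hμT : ∀ s, 0 ≤ μT s) (hμN : ∀ s, 0 ≤ μN s) (hτ : ∀ s, 0 ≤ τ s)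
    (h₁T : ∑ s ∈ Finset.Ico 2 s₀, ((s : ℕ) : ℝ) ^ 2 * μT s ≤ B₁T) (h₁N : ∑ s ∈ Finset.Ico 2 s₀, ((s : ℕ) : ℝ) ^ 2 * μN s ≤ B₁N)
    (h₂ : ∀ N : ℕ, ∑ s ∈ Finset.Ico s₀ N, ((s : ℕ) : ℝ) ^ 2 * τ s ≤ B₂)
    (hlam : 0 < lam) (hlamT : lam + (B₁T + B₂) ≤ lT) (hlamN : lam + (B₁N + B₂) ≤ lN) : TubeChannelData a b w ρ :=
  ⟨ν, lT, lN, lam, B₁T + B₂, B₁N + B₂, fun s => if s < s₀ then μT s else τ s, fun s => if s < s₀ then μN s else τ s, hν,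
    fun s => by dsimp only; split_ifs; exacts [hμT s, hτ s], fun s => by dsimp only; split_ifs; exacts [hμN s, hτ s],
    splice_budget hμT hτ h₁T h₂, splice_budget hμN hτ h₁N h₂, hlam, hlamT, hlamN, hA, isFarChannelModulus_splice hν hB hP⟩

end Splice

/-! ## §9 W′ level: CH «`TubeChannelsW' Λ ρ`» and the glue to 7c′ᶜ modulo pair moduli (tree-only) -/

section WLevel

open Summit.AtomisticToContinuum.Crystallization.Theorems.OverbindingBudgetElasticSplitShear (StressFree)
open Summit.AtomisticToContinuum.Crystallization.Theorems.ChartedPlanarOrderRigidityDoor (IsNash)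
open Summit.AtomisticToContinuum.Crystallization.Theorems.ChartedPlanarOrderDensityDichotomy (μS IsSep)
open Summit.AtomisticToContinuum.Crystallization.Theorems.ChartedPlanarOrderDoorLayered (Layered)
open Summit.AtomisticToContinuum.Crystallization.Theorems.OverbindingBudgetScaleWidening (IsCleanW)
open Summit.AtomisticToContinuum.Crystallization.Theorems.ChartedPlanarOrderCleanScaleP (cleanStackedIndependentW)
open Summit.AtomisticToContinuum.Crystallization.Theorems.ChartedPlanarOrderTubeConvexSplit (TubeConvexityW' TubeConvexityW)
open Summit.AtomisticToContinuum.Crystallization.Theorems.ChartedPlanarOrderStraddleLipschitz (summable_famOf_tube PairModulusW'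
  PairModulusW pairModulusW'_of_W)

/-- ★ CH · **`TubeChannelsW' Λ ρ`** — channel dominance data on the `ρ`-tube round every admissible ZERO-GAP-STRESS stacked configuration
(`TubeConvexW'`'s binder list verbatim).  [CERT · INSTRUMENTABLE — census TAG 161b (i) BLOCKWISE reading: lateral block margin 1.66–2.31 and
normal block absorbed by `k_nn ≈ 20` at `ρ = 0.04` on the whole stress-free line; TAG 176 asks for the typed inputs `(λ_T, λ_N; μ_T, μ_N)`] -/
def TubeChannelsW' (Λ ρ : ℝ) : Prop :=
  ∀ δ : ℝ, 0 < δ → ∀ (a b : E3) (w : ℤ → E3), ‖a‖ ≤ Λ → ‖b‖ ≤ Λ →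
    IsSep δ (Layered a b w) → IsCleanW (μS (Layered a b w)) → IsNash (μS (Layered a b w)) → IsStacked a b w →
    StressFree (Layered a b w) → (∀ m : ℤ, gapStress a b m (incr w) = 0) → TubeChannelData a b w ρ

/-- **`TubeChannelsW Λ ρ`** — the same on `TubeConvexW`'s (IsNash-only) binder list; STRONGER than `TubeChannelsW'`. [CERT] -/
def TubeChannelsW (Λ ρ : ℝ) : Prop :=
  ∀ δ : ℝ, 0 < δ → ∀ (a b : E3) (w : ℤ → E3), ‖a‖ ≤ Λ → ‖b‖ ≤ Λ →
    IsSep δ (Layered a b w) → IsCleanW (μS (Layered a b w)) → IsNash (μS (Layered a b w)) → IsStacked a b w →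
    TubeChannelData a b w ρ

/-- The `W` form of the channel statement implies the `W′` form. [folklore] -/
theorem tubeChannelsW'_of_W {Λ ρ : ℝ} (h : TubeChannelsW Λ ρ) : TubeChannelsW' Λ ρ :=
  fun δ hδ a b w ha hb hs hc hn hst _ _ => h δ hδ a b w ha hb hs hc hn hst

/-- ★★ glue modulo pair moduli: `PairModulusW' Λ ρ → TubeChannelsW' Λ ρ → TubeConvexityW' Λ ρ` (straddle summability on the tube from the
pair moduli via the tree's `summable_famOf_tube`; then the channel seam). -/
theorem tubeConvexityW'_of_pairModulus_channels {Λ ρ : ℝ} (hP : PairModulusW' Λ ρ) (hC : TubeChannelsW' Λ ρ) :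
    TubeConvexityW' Λ ρ := by
  intro δ hδ a b w ha hb hs hc hn hst hf hz
  obtain ⟨τ, hτ0, hτ3, hPM⟩ := hP δ hδ a b w ha hb hs hc hn hst hf hz
  have hab := cleanStackedIndependentW δ hδ a b w hs hc hst
  exact tubeConvexityData_of_channels (fun m h hh => summable_famOf_tube hδ hab hst hs hτ0 hτ3 hPM m hh)
    (hC δ hδ a b w ha hb hs hc hn hst hf hz)

/-- IsNash-only twin: `PairModulusW Λ ρ → TubeChannelsW Λ ρ → TubeConvexityW Λ ρ`. -/
theorem tubeConvexityW_of_pairModulus_channels {Λ ρ : ℝ} (hP : PairModulusW Λ ρ) (hC : TubeChannelsW Λ ρ) :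
    TubeConvexityW Λ ρ := by
  intro δ hδ a b w ha hb hs hc hn hst
  obtain ⟨τ, hτ0, hτ3, hPM⟩ := hP δ hδ a b w ha hb hs hc hn hst
  have hab := cleanStackedIndependentW δ hδ a b w hs hc hst
  exact tubeConvexityData_of_channels (fun m h hh => summable_famOf_tube hδ hab hst hs hτ0 hτ3 hPM m hh)
    (hC δ hδ a b w ha hb hs hc hn hst)

/-! ## §10 W′-level LEAVES with explicit constant slots: CHᴬ-W′, CHꜰ-W′ below `s₀`, the Lipschitz tail, and the glue to CH -/

/-- in `ℝ³` two linearly independent vectors have a common unit normal. -/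
theorem exists_unit_normal {a b : E3} (hab : LinearIndependent ℝ ![a, b]) : ∃ ν : E3, ‖ν‖ = 1 ∧ ⟪ν, a⟫ = 0 ∧ ⟪ν, b⟫ = 0 := by
  have h2 : Module.finrank ℝ (Submodule.span ℝ (Set.range ![a, b])) = 2 := by
    rw [finrank_span_eq_card hab]; simp
  have h3 := Submodule.finrank_add_finrank_orthogonal (Submodule.span ℝ (Set.range ![a, b]))
  rw [h2, finrank_euclideanSpace_fin] at h3
  have hne : (Submodule.span ℝ (Set.range ![a, b]))ᗮ ≠ ⊥ := by
    intro hbot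
    rw [hbot, finrank_bot] at h3
    omega
  obtain ⟨v, hv, hv0⟩ := Submodule.exists_mem_ne_zero_of_ne_bot hne
  have ha : a ∈ Submodule.span ℝ (Set.range ![a, b]) := Submodule.subset_span ⟨0, rfl⟩
  have hb : b ∈ Submodule.span ℝ (Set.range ![a, b]) := Submodule.subset_span ⟨1, rfl⟩
  refine ⟨(‖v‖⁻¹ : ℝ) • v, norm_smul_inv_norm hv0, ?_, ?_⟩
  · rw [real_inner_smul_left, real_inner_comm, Submodule.inner_right_of_mem_orthogonal ha hv, mul_zero]
  · rw [real_inner_smul_left, real_inner_comm, Submodule.inner_right_of_mem_orthogonal hb hv, mul_zero]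

/-- ★ LEAF CHᴬ-W′ · `AdjacentChannelW' Λ ρ λ_T λ_N` — adjacent channel monotonicity with the UNIFORM constants `(λ_T, λ_N)` round every admissible
zero-gap-stress stacked configuration, channels w.r.t. any unit normal `ν ⊥ a, b` (the piece is even in `ν`). [CERT · INSTRUMENTABLE (TAG 176 (i))] -/
def AdjacentChannelW' (Λ ρ lT lN : ℝ) : Prop :=
  ∀ δ : ℝ, 0 < δ → ∀ (a b : E3) (w : ℤ → E3), ‖a‖ ≤ Λ → ‖b‖ ≤ Λ →
    IsSep δ (Layered a b w) → IsCleanW (μS (Layered a b w)) → IsNash (μS (Layered a b w)) → IsStacked a b w →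
    StressFree (Layered a b w) → (∀ m : ℤ, gapStress a b m (incr w) = 0) →
    ∀ ν : E3, ‖ν‖ = 1 → ⟪ν, a⟫ = 0 → ⟪ν, b⟫ = 0 → IsAdjacentChannelMono a b w ρ ν lT lN

/-- ★ LEAF CHꜰ-W′ below `s₀` · `FarChannelBelowW' Λ ρ μ_T μ_N s₀` — far channel moduli for the spans `2 ≤ s < s₀` with UNIFORM sequences
`(μ_T, μ_N)`. [CERT · finitely many · INSTRUMENTABLE (TAG 176 (ii))] -/
def FarChannelBelowW' (Λ ρ : ℝ) (μT μN : ℕ → ℝ) (s₀ : ℕ) : Prop :=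
  ∀ δ : ℝ, 0 < δ → ∀ (a b : E3) (w : ℤ → E3), ‖a‖ ≤ Λ → ‖b‖ ≤ Λ →
    IsSep δ (Layered a b w) → IsCleanW (μS (Layered a b w)) → IsNash (μS (Layered a b w)) → IsStacked a b w →
    StressFree (Layered a b w) → (∀ m : ℤ, gapStress a b m (incr w) = 0) →
    ∀ ν : E3, ‖ν‖ = 1 → ⟪ν, a⟫ = 0 → ⟪ν, b⟫ = 0 → IsFarChannelModulusBelow a b w ρ ν μT μN s₀

/-- ★ LEAF tail · `PairModulusTailW' Λ ρ s₀ B₂` — Lipschitz span moduli `τ ≥ 0` with an EXPLICIT uniform tail budget `Σ_{s₀ ≤ s < N} s² τ_s ≤ B₂`.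
[ANALYTIC · (v)'s `isPairModulus_of_heightFloor` gives `τ_s = K s⁻⁶` explicitly; the constant / the cut `s₀` are the work] -/
def PairModulusTailW' (Λ ρ : ℝ) (s₀ : ℕ) (B₂ : ℝ) : Prop :=
  ∀ δ : ℝ, 0 < δ → ∀ (a b : E3) (w : ℤ → E3), ‖a‖ ≤ Λ → ‖b‖ ≤ Λ →
    IsSep δ (Layered a b w) → IsCleanW (μS (Layered a b w)) → IsNash (μS (Layered a b w)) → IsStacked a b w →
    StressFree (Layered a b w) → (∀ m : ℤ, gapStress a b m (incr w) = 0) →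
    ∃ τ : ℕ → ℝ, (∀ s, 0 ≤ τ s) ∧ (∀ N : ℕ, ∑ s ∈ Finset.Ico s₀ N, ((s : ℕ) : ℝ) ^ 2 * τ s ≤ B₂) ∧ IsPairModulus a b w ρ τ

/-- ★★ glue of the leaves: CHᴬ-W′ ∧ CHꜰ-W′(< s₀) ∧ tail(s₀, B₂) ∧ the dominance arithmetic `λ + B₁T + B₂ ≤ λ_T`, `λ + B₁N + B₂ ≤ λ_N` ⇒ CH
`TubeChannelsW' Λ ρ` (the common unit normal from `exists_unit_normal` + `cleanStackedIndependentW`). -/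
theorem tubeChannelsW'_of_leaves {Λ ρ lT lN lam B₁T B₁N B₂ : ℝ} {μT μN : ℕ → ℝ} {s₀ : ℕ}
    (hA : AdjacentChannelW' Λ ρ lT lN) (hB : FarChannelBelowW' Λ ρ μT μN s₀) (hP : PairModulusTailW' Λ ρ s₀ B₂)
    (hμT : ∀ s, 0 ≤ μT s) (hμN : ∀ s, 0 ≤ μN s)
    (h₁T : ∑ s ∈ Finset.Ico 2 s₀, ((s : ℕ) : ℝ) ^ 2 * μT s ≤ B₁T) (h₁N : ∑ s ∈ Finset.Ico 2 s₀, ((s : ℕ) : ℝ) ^ 2 * μN s ≤ B₁N)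
    (hlam : 0 < lam) (hlamT : lam + (B₁T + B₂) ≤ lT) (hlamN : lam + (B₁N + B₂) ≤ lN) : TubeChannelsW' Λ ρ := by
  intro δ hδ a b w ha hb hs hc hn hst hf hz
  obtain ⟨ν, hν, hνa, hνb⟩ := exists_unit_normal (cleanStackedIndependentW δ hδ a b w hs hc hst)
  obtain ⟨τ, hτ0, hτB, hPM⟩ := hP δ hδ a b w ha hb hs hc hn hst hf hz
  exact tubeChannelData_of_certs hν (hA δ hδ a b w ha hb hs hc hn hst hf hz ν hν hνa hνb)
    (hB δ hδ a b w ha hb hs hc hn hst hf hz ν hν hνa hνb) hPM hμT hμN hτ0 h₁T h₁N hτB hlam hlamT hlamN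

end WLevel

/-! ## §11 Unconditional corollaries in the range of (v)/(w) and the cones with slot 7 = CH -/

section Record

open Summit.AtomisticToContinuum.Crystallization.Theses.OverbindingBudget (RobustDefectLimitWindows)
open Summit.AtomisticToContinuum.Crystallization.Theses.PricedLinkCensus (ChargedEnergyGap)
open Summit.AtomisticToContinuum.Crystallization.Theorems.OverbindingBudgetGradedBareness (CleanlessExcessT)
open Summit.AtomisticToContinuum.Crystallization.Theorems.OverbindingBudgetCoherentCut (CoherentResidual)
open Summit.AtomisticToContinuum.Crystallization.Theorems.OverbindingBudgetUniformCutStatements (GrossCleanBallsU)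
open Summit.AtomisticToContinuum.Crystallization.Theorems.OverbindingBudgetElasticSplitScale (CompressedVirialLaw)
open Summit.AtomisticToContinuum.Crystallization.Theorems.OverbindingBudgetScaleWidening (DoorPeriodicW)
open Summit.AtomisticToContinuum.Crystallization.Theorems.OverbindingBudgetTwoShellShape (TwoShellShape BarlowGluingW)
open Summit.AtomisticToContinuum.Crystallization.Theorems.OverbindingBudgetStackedRigidityW (StackedReductionW GapStressVanishesW
  BasalReferenceW)
open Summit.AtomisticToContinuum.Crystallization.Theorems.OverbindingBudgetStackedRigidityRef (RegistryPinningW)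
open Summit.AtomisticToContinuum.Crystallization.Theorems.OverbindingBudgetStackedRigidityUniq (TubeUniquenessW)
open Summit.AtomisticToContinuum.Crystallization.Theorems.ChartedPlanarOrderTubeConvex (TubeConvexW' TubeConvexW ProfileSlavingLJW
  tubeUniquenessW_of_tubeConvexW' profileSlavingLJW_of_tubeConvexW)
open Summit.AtomisticToContinuum.Crystallization.Theorems.ChartedPlanarOrderTubeConvexSplit (TubeConvexityW' TubeConvexityW)
open Summit.AtomisticToContinuum.Crystallization.Theorems.ChartedPlanarOrderStraddleLipschitz (PairModulusW' PairModulusW)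
open Summit.AtomisticToContinuum.Crystallization.Theorems.ChartedPlanarOrderTubeLipschitz (pairModulusW'_of_le pairModulusW_of_le
  tubeConvexW'_of_convexityW' tubeConvexW_of_convexityW rdef_of_grossU_shape_gluing_pinning_convexityW')

/-- ★★ `TubeChannelsW' Λ ρ → TubeConvexityW' Λ ρ` for `Λ ≤ 17/16`, `ρ < 19/50` (pair moduli from (v)/(w)). -/
theorem tubeConvexityW'_of_channels {Λ ρ : ℝ} (hΛ : Λ ≤ 17 / 16) (hρ : ρ < 19 / 50) (hC : TubeChannelsW' Λ ρ) : TubeConvexityW' Λ ρ :=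
  tubeConvexityW'_of_pairModulus_channels (pairModulusW'_of_le hΛ hρ) hC

/-- the IsNash-only twin: `TubeChannelsW Λ ρ → TubeConvexityW Λ ρ`. -/
theorem tubeConvexityW_of_channels {Λ ρ : ℝ} (hΛ : Λ ≤ 17 / 16) (hρ : ρ < 19 / 50) (hC : TubeChannelsW Λ ρ) : TubeConvexityW Λ ρ :=
  tubeConvexityW_of_pairModulus_channels (pairModulusW_of_le hΛ hρ) hC

/-- ★★ SLOT 7c′ from CH: `TubeChannelsW' Λ ρ → TubeConvexW' Λ ρ` for `Λ ≤ 17/16`, `ρ < 19/50`. -/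
theorem tubeConvexW'_of_channels {Λ ρ : ℝ} (hΛ : Λ ≤ 17 / 16) (hρ : ρ < 19 / 50) (hC : TubeChannelsW' Λ ρ) : TubeConvexW' Λ ρ :=
  tubeConvexW'_of_convexityW' hΛ hρ (tubeConvexityW'_of_channels hΛ hρ hC)

/-- the IsNash-only twin: `TubeChannelsW Λ ρ → TubeConvexW Λ ρ`. -/
theorem tubeConvexW_of_channels {Λ ρ : ℝ} (hΛ : Λ ≤ 17 / 16) (hρ : ρ < 19 / 50) (hC : TubeChannelsW Λ ρ) : TubeConvexW Λ ρ :=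
  tubeConvexW_of_convexityW hΛ hρ (tubeConvexityW_of_channels hΛ hρ hC)

/-- ★★★ OF RECORD: `TubeChannelsW' (17/16) (1/40) → TubeConvexW' (17/16) (1/40)`. -/
theorem tubeConvexW'_record_of_channels (hC : TubeChannelsW' (17 / 16) (1 / 40)) : TubeConvexW' (17 / 16) (1 / 40) :=
  tubeConvexW'_of_channels le_rfl (by norm_num) hC

/-- the F2 feeder (literal name): `TubeChannelsW' Λ ρ → TubeUniquenessW Λ ρ`. -/
theorem tubeUniquenessW_of_channels {Λ ρ : ℝ} (hΛ : Λ ≤ 17 / 16) (hρ : ρ < 19 / 50) (hC : TubeChannelsW' Λ ρ) : TubeUniquenessW Λ ρ :=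
  tubeUniquenessW_of_tubeConvexW' (tubeConvexW'_of_channels hΛ hρ hC)

/-- the PS column: `TubeChannelsW Λ η → ProfileSlavingLJW Λ η`. -/
theorem profileSlavingLJW_of_channels {Λ η : ℝ} (hΛ : Λ ≤ 17 / 16) (hη : η < 19 / 50) (hC : TubeChannelsW Λ η) : ProfileSlavingLJW Λ η :=
  profileSlavingLJW_of_tubeConvexW (tubeConvexW_of_channels hΛ hη hC)

/-- ★ **RDEF cone `…_pinning_channels`**: lens-4's cone of record with slot 7 fed by CH `TubeChannelsW' Λ₁ ρ₀` (`Λ₁ ≤ 17/16`, `ρ₀ < 19/50`). -/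
theorem rdef_of_grossU_shape_gluing_pinning_channels (Λ Λ₁ ρ₀ ρ₁ : ℝ) (hΛ₁ : Λ₁ ≤ 17 / 16) (hρ₀ : ρ₀ < 19 / 50)
    (hG : GrossCleanBallsU (1 / 250) 10) (hCEG : ChargedEnergyGap) (hC : CompressedVirialLaw (1 / 250) 10)
    (hS : TwoShellShape (1 / 100) (3 / 50) (1 / 450)) (hB₂ : BarlowGluingW) (hD : DoorPeriodicW Λ) (hSR : StackedReductionW Λ Λ₁)
    (hV : GapStressVanishesW Λ₁) (hP : RegistryPinningW Λ₁ ρ₀ ρ₁) (hT : TubeChannelsW' Λ₁ ρ₀) (hRef : BasalReferenceW Λ₁ ρ₁)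
    (hCE : CleanlessExcessT) (hRes : CoherentResidual 10) : RobustDefectLimitWindows :=
  rdef_of_grossU_shape_gluing_pinning_convexityW' Λ Λ₁ ρ₀ ρ₁ hΛ₁ hρ₀ hG hCEG hC hS hB₂ hD hSR hV hP (tubeConvexityW'_of_channels hΛ₁ hρ₀ hT)
    hRef hCE hRes

/-- the cone OF RECORD with slot 7 = CH: `(Λ, Λ₁; ρ₀, ρ₁) = (2, 17/16; 1/40, 3/16)`. -/
theorem rdef_of_grossU_shape_gluing_pinning_channels_record (hG : GrossCleanBallsU (1 / 250) 10) (hCEG : ChargedEnergyGap)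
    (hC : CompressedVirialLaw (1 / 250) 10) (hS : TwoShellShape (1 / 100) (3 / 50) (1 / 450)) (hB₂ : BarlowGluingW) (hD : DoorPeriodicW 2)
    (hSR : StackedReductionW 2 (17 / 16)) (hV : GapStressVanishesW (17 / 16)) (hP : RegistryPinningW (17 / 16) (1 / 40) (3 / 16))
    (hT : TubeChannelsW' (17 / 16) (1 / 40)) (hRef : BasalReferenceW (17 / 16) (3 / 16)) (hCE : CleanlessExcessT)
    (hRes : CoherentResidual 10) : RobustDefectLimitWindows :=
  rdef_of_grossU_shape_gluing_pinning_channels 2 (17 / 16) (1 / 40) (3 / 16) le_rfl (by norm_num) hG hCEG hC hS hB₂ hD hSR hV hP hT hRef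
    hCE hRes

/-- ★ slot 7c′ of record from the LEAVES: CHᴬ-W′, CHꜰ-W′ below `s₀`, the Lipschitz tail and the channelwise dominance arithmetic at
`(Λ, ρ) = (17/16, 1/40)` give `TubeConvexW' (17/16) (1/40)`. -/
theorem tubeConvexW'_record_of_leaves {lT lN lam B₁T B₁N B₂ : ℝ} {μT μN : ℕ → ℝ} {s₀ : ℕ}
    (hA : AdjacentChannelW' (17/16) (1/40) lT lN) (hB : FarChannelBelowW' (17/16) (1/40) μT μN s₀)
    (hP : PairModulusTailW' (17/16) (1/40) s₀ B₂) (hμT : ∀ s, 0 ≤ μT s) (hμN : ∀ s, 0 ≤ μN s)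
    (h₁T : ∑ s ∈ Finset.Ico 2 s₀, ((s : ℕ) : ℝ) ^ 2 * μT s ≤ B₁T) (h₁N : ∑ s ∈ Finset.Ico 2 s₀, ((s : ℕ) : ℝ) ^ 2 * μN s ≤ B₁N)
    (hlam : 0 < lam) (hlamT : lam + (B₁T + B₂) ≤ lT) (hlamN : lam + (B₁N + B₂) ≤ lN) : TubeConvexW' (17/16) (1/40) :=
  tubeConvexW'_record_of_channels (tubeChannelsW'_of_leaves hA hB hP hμT hμN h₁T h₁N hlam hlamT hlamN)

end Record

end Summit.AtomisticToContinuum.Crystallization.Theorems.ChartedPlanarOrderTubeChannels
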